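import Summits.FinalStateConjecture.FinalStateConjecture.Theorems.SwallowTheDatumKerrShieldedSettlesStubCollarCauchyAux
import Literature.Geometry.Lorentzian.MinkowskiCauchy
import Literature.Geometry.Lorentzian.OpensCausality
import Literature.Geometry.Lorentzian.KerrData
import HarnessLib

/-!
# `KerrShieldedSettles`, line `tapered-temporal-collar` — stub S1 `stub_collarCauchy`, part 2 (the lever)

Support file for crux `stmt-FinalStateConjecture-10054`
(`Summit.FinalStateConjecture.FinalStateConjecture.Theses.SwallowTheDatum.KerrShieldedSettles`): the registered
stub `stub_collarCauchy` — **the bent leaf `Σᵉ = {x⁰ = T(r x)}` (`T = bentHeight M a`, the crux's hard-coded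
height) is a Cauchy hypersurface of the tapered collar `W = {x ∈ Kerr.region a r₁ | 0 < x⁰ − T(r x) + (r x − r₁)/4}`
of the ingoing Kerr–Schild chart**, in unfolded chart form: every future-timelike chart curve on an
order-connected nonempty parameter set, lying in `W` and without future/past endpoint in `W`, meets `Σᵉ`
exactly once (consumed verbatim by S3 `stub_collarEmbedsMGHD`).

Proof (order theory of two temporal functions).  Along a future timelike curve `γ` of the chart the
coordinate curve is a future timelike curve of MINKOWSKI space (`η(v,v) ≤ g(v,v)`, `g(V,v) = −v⁰`;
`minkowski_curve`), so `MinkowskiCauchy.lean` supplies monotone time, the Lipschitz bound on the spatial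
part and the endpoint lemmas.  The clocks of part 1 give: `u = t* − T(r)` and `w = u + (r − r₁)/4` strictly
increasing (`strictMonoOn_u`, `strictMonoOn_w`), `r` strictly decreasing while `r₋ < r < r₊`
(`strictAntiOn_radius`).  Uniqueness of the crossing: monotonicity of `u`.  Existence: otherwise `u` has a
sign on `s` (intermediate value theorem).  If `u < 0`, then `t* < T(r) ≤ r/2 + M ≤ (C + t*)/2 + M` bounds
`t*` above (`bddAbove_time_of_u_neg`), so `γ` has a future endpoint `q` in `E4` with `w(q) > 0 ≥ u(q)`,
whence `r(q) > r₁` and `q ∈ W` — a future endpoint in `W`.  If `u > 0`, then `t* = u + T > 0` is bounded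
below, so `γ` has a past endpoint `q` in `E4` with `u(q) ≥ 0`, `r(q) ≥ r₁`; `r(q) > r₁` gives a past
endpoint in `W`, and `r(q) = r₁ < r₊` is excluded by the hole clock (pastward `r` increases away from `r₁`).
Template: `Minkowski.isCauchyHypersurface_range_sliceEmbed`.

References: O'Neill 1983, Ch. 14, Def. 14.28; Hawking–Ellis 1973, §6.2 (endpoints), §6.5;
Dafermos–Rodnianski arXiv:0811.0354 §5.1.
-/

set_option linter.dupNamespace false

noncomputable section

open Set Filter
open scoped Manifold ContDiff Topology
open Literature.Geometry.Lorentzian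
open Summit.FinalStateConjecture.FinalStateConjecture.Theorems.KerrShieldedDataExist.Negative
  (bentHeight bentHeight_eq_literal bentSlope mass_pos bentSlope_nonneg rMinus_nonneg hasDerivAt_bentHeight
  continuous_bentHeight)
open Summit.FinalStateConjecture.FinalStateConjecture.Theorems.KerrShieldedSettles.Negative (minkowski_le_bilin)

namespace Summit.FinalStateConjecture.FinalStateConjecture.Theorems.SwallowTheDatum.KerrShieldedSettles

namespace CollarCauchy

/-! ## Curve-level lemmas: the clocks along a future timelike curve of the Kerr chart -/

section Curve

variable [Kerr.Facts] {M a r₁ : ℝ} {hM : 0 ≤ M} {γ : ℝ → Kerr.region a r₁} {s : Set ℝ}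

omit [Kerr.Facts] in
/-- The chart velocity of a curve in the Kerr–Schild chart is the derivative of its coordinate
expression (`d(Subtype.val) = id`; both sides are the junk `0` off the differentiability locus). [folklore] -/
theorem velocity_eq_deriv (γ : ℝ → Kerr.region a r₁) (t : ℝ) :
    (velocity 𝓘(ℝ, E4) γ t : E4) = deriv (fun σ => (γ σ : E4)) t := by
  rw [← velocity_subtypeVal_comp (I := 𝓘(ℝ, E4)) (Kerr.region a r₁) γ t]
  unfold velocity
  rw [mfderiv_eq_fderiv]
  rfl

/-- Along a future timelike curve of the Kerr chart the coordinate curve is differentiable with velocity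
`v`, `g(v, v) < 0` and `g(V, v) < 0`. [folklore] -/
theorem curve_velocity (hγ : (Kerr.smoothMetric M a r₁).IsFutureTimelikeCurveOn
      ((Kerr.timeOrientation M a r₁ hM).ofLE le_top) γ s) {t : ℝ} (ht : t ∈ s) :
    HasDerivAt (fun σ => (γ σ : E4)) (deriv (fun σ => (γ σ : E4)) t) t ∧
      Kerr.bilin M a (γ t) (deriv (fun σ => (γ σ : E4)) t) (deriv (fun σ => (γ σ : E4)) t) < 0 ∧
      Kerr.bilin M a (γ t) (Kerr.timeVector M a (γ t)) (deriv (fun σ => (γ σ : E4)) t) < 0 := by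
  obtain ⟨hd, htl, hfd⟩ := hγ t ht
  have hd' : DifferentiableAt ℝ (fun σ => (γ σ : E4)) t :=
    mdifferentiableAt_iff_differentiableAt.mp
      ((mdifferentiableAt_subtypeVal_comp_curve_iff (I := 𝓘(ℝ, E4)) (Kerr.region a r₁)).2 hd)
  have hv := velocity_eq_deriv γ t
  refine ⟨hd'.hasDerivAt, ?_, ?_⟩
  · have h1 : Kerr.bilin M a (γ t) (velocity 𝓘(ℝ, E4) γ t) (velocity 𝓘(ℝ, E4) γ t) < 0 := htl
    rwa [hv] at h1
  · have h2 : Kerr.bilin M a (γ t) (Kerr.timeVector M a (γ t)) (velocity 𝓘(ℝ, E4) γ t) < 0 := hfd.2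
    rwa [hv] at h2

/-- **Cone comparison** (`η(v, v) ≤ g(v, v)`, `g(V, v) = −v⁰`): the coordinate expression of a future
timelike curve of the Kerr chart is a future timelike curve of Minkowski spacetime, so the whole of
`MinkowskiCauchy.lean` (monotone time, Lipschitz spatial part, endpoints) applies to it. [folklore] -/
theorem minkowski_curve (hγ : (Kerr.smoothMetric M a r₁).IsFutureTimelikeCurveOn
      ((Kerr.timeOrientation M a r₁ hM).ofLE le_top) γ s) :
    Minkowski.spacetime.metric.IsFutureTimelikeCurveOn Minkowski.spacetime.timeOrientation
      (fun σ => (γ σ : E4)) s := by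
  intro t ht
  obtain ⟨hd, htl, hfd⟩ := curve_velocity hγ ht
  have hd' : MDifferentiableAt 𝓘(ℝ, ℝ) 𝓘(ℝ, E4) (fun σ => (γ σ : E4)) t :=
    mdifferentiableAt_iff_differentiableAt.mpr hd.differentiableAt
  have hv : (velocity (𝓡 4) (fun σ => (γ σ : E4)) t : E4) = deriv (fun σ => (γ σ : E4)) t := by
    unfold velocity; rw [mfderiv_eq_fderiv]; rfl
  have hx : 0 < Kerr.radius a (γ t) := Kerr.radius_pos_of_mem_region (γ t).2
  have hη : Minkowski.bilin (deriv (fun σ => (γ σ : E4)) t) (deriv (fun σ => (γ σ : E4)) t) < 0 :=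
    (minkowski_le_bilin hM a _ _).trans_lt htl
  have hv0 : 0 < deriv (fun σ => (γ σ : E4)) t 0 := by
    rwa [Kerr.bilin_timeVector hx, neg_lt_zero] at hfd
  refine ⟨hd', ?_, ⟨?_, ?_⟩, ?_⟩
  · change Minkowski.bilin (velocity (𝓡 4) (fun σ => (γ σ : E4)) t)
      (velocity (𝓡 4) (fun σ => (γ σ : E4)) t) < 0
    rw [hv]; exact hη
  · change Minkowski.bilin (velocity (𝓡 4) (fun σ => (γ σ : E4)) t)
      (velocity (𝓡 4) (fun σ => (γ σ : E4)) t) ≤ 0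
    rw [hv]; exact hη.le
  · have hne : deriv (fun σ => (γ σ : E4)) t ≠ (0 : E4) := fun h => by
      rw [h] at hv0
      simp at hv0
    intro h0
    exact hne (hv.symm.trans h0)
  · change Minkowski.bilin (E4.basisVector 0) (velocity (𝓡 4) (fun σ => (γ σ : E4)) t) < 0
    rw [hv, Minkowski.bilin_basisVector_zero_left]; linarith

/-- `d/dσ r(γ σ) = dr(v⃗)` (chain rule with `Kerr.hasFDerivAt_radius`). [folklore] -/
theorem hasDerivAt_radius_comp (hγ : (Kerr.smoothMetric M a r₁).IsFutureTimelikeCurveOn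
      ((Kerr.timeOrientation M a r₁ hM).ofLE le_top) γ s) {t : ℝ} (ht : t ∈ s) :
    HasDerivAt (fun σ => Kerr.radius a (γ σ))
      (Kerr.radiusGrad a (E4.spatial (γ t : E4)) (E4.spatial (deriv (fun σ => (γ σ : E4)) t))) t := by
  have h1 := (curve_velocity hγ ht).1
  have hx : 0 < Kerr.radius a (γ t) := Kerr.radius_pos_of_mem_region (γ t).2
  have := (Kerr.hasFDerivAt_radius hx).comp_hasDerivAt t h1
  simpa [Function.comp_def] using this

/-- `d/dσ u(γ σ) = v⁰ − T′(r) dr(v⃗)` for `u = t* − T(r)`. [folklore] -/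
theorem hasDerivAt_u (ha : |a| < M) (hγ : (Kerr.smoothMetric M a r₁).IsFutureTimelikeCurveOn
      ((Kerr.timeOrientation M a r₁ hM).ofLE le_top) γ s) {t : ℝ} (ht : t ∈ s) :
    HasDerivAt (fun σ => (γ σ : E4) 0 - bentHeight M a (Kerr.radius a (γ σ)))
      (deriv (fun σ => (γ σ : E4)) t 0 - bentSlope M a (Kerr.radius a (γ t)) *
        Kerr.radiusGrad a (E4.spatial (γ t : E4)) (E4.spatial (deriv (fun σ => (γ σ : E4)) t))) t :=
  (Minkowski.hasDerivAt_time (minkowski_curve hγ) ht).sub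
    ((hasDerivAt_bentHeight ha _).comp t (hasDerivAt_radius_comp hγ ht))

/-- **`u = t* − T(r)` is strictly increasing along future timelike curves** of the Kerr chart
(`clock_pos` with the slope `T′`, mean value theorem). [folklore] -/
theorem strictMonoOn_u (ha : |a| < M) (hs : s.OrdConnected)
    (hγ : (Kerr.smoothMetric M a r₁).IsFutureTimelikeCurveOn
      ((Kerr.timeOrientation M a r₁ hM).ofLE le_top) γ s) :
    StrictMonoOn (fun σ => (γ σ : E4) 0 - bentHeight M a (Kerr.radius a (γ σ))) s := by
  refine strictMonoOn_of_deriv_pos hs.convex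
    (fun t ht => (hasDerivAt_u ha hγ ht).continuousAt.continuousWithinAt) fun t ht => ?_
  have ht' := interior_subset ht
  rw [(hasDerivAt_u ha hγ ht').deriv]
  obtain ⟨-, htl, hfd⟩ := curve_velocity hγ ht'
  have hx : 0 < Kerr.radius a (γ t) := Kerr.radius_pos_of_mem_region (γ t).2
  have hH := Kerr.scalarH_nonneg hM a (γ t : E4)
  have hκ := bentSlope_nonneg ha (Kerr.radius a (γ t))
  exact clock_pos hM hx (numerator_bentSlope_neg ha hx) (by positivity) htl.le
    (fun h0 => by rw [h0] at htl; simp at htl) hfd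

/-- **`w = u + (r − r₁)/4` is strictly increasing along future timelike curves** in `{r > r₁}`,
`r₁ > r₋` (`clock_pos` with the slope `T′ − ¼`). [folklore] -/
theorem strictMonoOn_w (ha : |a| < M) (h₁ : Kerr.rMinus M a < r₁) (hs : s.OrdConnected)
    (hγ : (Kerr.smoothMetric M a r₁).IsFutureTimelikeCurveOn
      ((Kerr.timeOrientation M a r₁ hM).ofLE le_top) γ s) :
    StrictMonoOn (fun σ => (γ σ : E4) 0 - bentHeight M a (Kerr.radius a (γ σ)) +
      (Kerr.radius a (γ σ) - r₁) / 4) s := by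
  have hder : ∀ t ∈ s, HasDerivAt (fun σ => (γ σ : E4) 0 - bentHeight M a (Kerr.radius a (γ σ)) +
      (Kerr.radius a (γ σ) - r₁) / 4)
      (deriv (fun σ => (γ σ : E4)) t 0 - (bentSlope M a (Kerr.radius a (γ t)) - 1 / 4) *
        Kerr.radiusGrad a (E4.spatial (γ t : E4)) (E4.spatial (deriv (fun σ => (γ σ : E4)) t))) t := by
    intro t ht
    refine ((hasDerivAt_u ha hγ ht).add
      (((hasDerivAt_radius_comp hγ ht).sub_const r₁).div_const 4)).congr_deriv ?_
    ring
  refine strictMonoOn_of_deriv_pos hs.convex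
    (fun t ht => (hder t ht).continuousAt.continuousWithinAt) fun t ht => ?_
  have ht' := interior_subset ht
  rw [(hder t ht').deriv]
  obtain ⟨-, htl, hfd⟩ := curve_velocity hγ ht'
  have hx : 0 < Kerr.radius a (γ t) := Kerr.radius_pos_of_mem_region (γ t).2
  have hm : Kerr.rMinus M a < Kerr.radius a (γ t) := h₁.trans (Kerr.lt_radius_of_mem_region (γ t).2)
  have hH := Kerr.scalarH_nonneg hM a (γ t : E4)
  have hκ := bentSlope_nonneg ha (Kerr.radius a (γ t))
  exact clock_pos hM hx (numerator_bentSlope_sub_quarter_neg ha hx hm)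
    (by nlinarith [mul_nonneg hH hκ]) htl.le (fun h0 => by rw [h0] at htl; simp at htl) hfd

/-- **The hole clock along curves**: on a parameter interval where the curve stays in `r₋ < r < r₊`,
`r` is strictly decreasing (`clock_neg` with the slope of `exists_hole_slope`). O'Neill 1995, Ch. 2. [folklore] -/
theorem strictAntiOn_radius (ha : |a| < M) (h₁ : Kerr.rMinus M a < r₁) {s' : Set ℝ}
    (hs' : s'.OrdConnected) (hsub : s' ⊆ s)
    (hγ : (Kerr.smoothMetric M a r₁).IsFutureTimelikeCurveOn
      ((Kerr.timeOrientation M a r₁ hM).ofLE le_top) γ s)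
    (hlt : ∀ σ ∈ s', Kerr.radius a (γ σ) < Kerr.rPlus M a) :
    StrictAntiOn (fun σ => Kerr.radius a (γ σ)) s' := by
  refine strictAntiOn_of_deriv_neg hs'.convex
    (fun t ht => (hasDerivAt_radius_comp hγ (hsub ht)).continuousAt.continuousWithinAt) fun t ht => ?_
  have ht' := interior_subset ht
  rw [(hasDerivAt_radius_comp hγ (hsub ht')).deriv]
  obtain ⟨-, htl, hfd⟩ := curve_velocity hγ (hsub ht')
  have hx : 0 < Kerr.radius a (γ t) := Kerr.radius_pos_of_mem_region (γ t).2
  have hm : Kerr.rMinus M a < Kerr.radius a (γ t) := h₁.trans (Kerr.lt_radius_of_mem_region (γ t).2)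
  obtain ⟨K, hK, hnum, hco⟩ := exists_hole_slope ha hx hm (hlt t ht')
  have key := clock_neg hM hx hnum hco htl.le (fun h0 => by rw [h0] at htl; simp at htl) hfd
  have hv0 : 0 < deriv (fun σ => (γ σ : E4)) t 0 := by
    rwa [Kerr.bilin_timeVector hx, neg_lt_zero] at hfd
  by_contra hge
  push Not at hge
  nlinarith [mul_nonneg hK.le hge]

/-- **Futureward escape is impossible below the leaf**: if `u < 0` along the curve then `t*` is bounded
above on the parameter set (`t* < T(r) ≤ r/2 + M`, `r ≤ ‖x⃗‖ ≤ C + t*` by the speed limit). [folklore] -/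
theorem bddAbove_time_of_u_neg (ha : |a| < M) (hs : s.OrdConnected)
    (hγ : (Kerr.smoothMetric M a r₁).IsFutureTimelikeCurveOn
      ((Kerr.timeOrientation M a r₁ hM).ofLE le_top) γ s)
    (hu : ∀ σ ∈ s, (γ σ : E4) 0 - bentHeight M a (Kerr.radius a (γ σ)) < 0) :
    BddAbove ((fun σ => (γ σ : E4) 0) '' s) := by
  rcases s.eq_empty_or_nonempty with rfl | ⟨t₀, ht₀⟩
  · simp
  have hβ := minkowski_curve hγ
  refine ⟨max ((γ t₀ : E4) 0) (‖E4.spatial (γ t₀ : E4)‖ - (γ t₀ : E4) 0 + 2 * M), ?_⟩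
  rintro _ ⟨σ, hσ, rfl⟩
  rcases le_total σ t₀ with hle | hle
  · exact ((Minkowski.strictMonoOn_time hs hβ).monotoneOn hσ ht₀ hle).trans (le_max_left _ _)
  · have hsp := Minkowski.norm_spatial_sub_le hs hβ ht₀ hσ hle
    have hrle : Kerr.radius a (γ σ) ≤ ‖E4.spatial (γ σ : E4)‖ := Kerr.radius_le_spatialNorm a _
    have hT := bentHeight_le_half_add ha (Kerr.radius_nonneg a (γ σ : E4))
    have hns := norm_sub_norm_le (E4.spatial (γ σ : E4)) (E4.spatial (γ t₀ : E4))
    have huσ := hu σ hσ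
    refine le_trans ?_ (le_max_right _ _)
    simp only at hsp huσ ⊢
    linarith

end Curve

end CollarCauchy

open CollarCauchy in
/-- **S1 `stub_collarCauchy` — the bent leaf `Σᵉ = {x⁰ = T(r x)}` is a Cauchy hypersurface of the tapered
collar `W = {x ∈ Kerr.region a r₁ | 0 < x⁰ − T(r x) + (r x − r₁)/4}`** of the ingoing Kerr–Schild chart,
in unfolded chart form: for sub-extremal `(M, a)`, `0 ≤ M`, `r₋ < r₁ < r₊`, every future-timelike chart
curve `γ` on an order-connected nonempty parameter set `s`, lying in `W` on `s` and without future/past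
endpoint in `W`, meets `Σᵉ` exactly once.  ORDER THEORY of the two temporal functions `u = t* − T(r)` and
`w = u + (r − r₁)/4` (strictly increasing along future timelike curves: `clock_pos`), the hole clock
(`r` strictly decreasing on `r₋ < r < r₊`: `clock_neg`), the Kerr–Schild speed limit and
`0 ≤ T ≤ r/2 + M`; uniqueness by monotonicity of `u`, existence by the escape trichotomy and the
intermediate value theorem.  Template: `Minkowski.isCauchyHypersurface_range_sliceEmbed`.
O'Neill 1983, Ch. 14, Def. 14.28; Hawking–Ellis 1973, §6.2, §6.5. [cite: ONeillSemiRiemannian1983, Ch. 14, Def. 14.28 (p. 415)] -/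
theorem stub_collarCauchy : ∀ [Kerr.Facts] (M a r₁ : ℝ) (hM : 0 ≤ M), |a| < M →
    Kerr.rMinus M a < r₁ → r₁ < Kerr.rPlus M a →
    ∀ (γ : ℝ → Kerr.region a r₁) (s : Set ℝ), s.OrdConnected → s.Nonempty →
      (Kerr.smoothMetric M a r₁).IsFutureTimelikeCurveOn
          ((Kerr.timeOrientation M a r₁ hM).ofLE le_top) γ s →
      (∀ t ∈ s, 0 < (γ t : E4) 0 - bentHeight M a (Kerr.radius a (γ t : E4)) +
          (Kerr.radius a (γ t : E4) - r₁) / 4) →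
      (∀ q : Kerr.region a r₁, 0 < (q : E4) 0 - bentHeight M a (Kerr.radius a (q : E4)) +
          (Kerr.radius a (q : E4) - r₁) / 4 →
            ¬ HasFutureEndpoint γ s q ∧ ¬ HasPastEndpoint γ s q) →
      ∃! t, t ∈ s ∧ (γ t : E4) 0 = bentHeight M a (Kerr.radius a (γ t : E4)) := by
  intro _ M a r₁ hM ha h₁ h₂ γ s hs hne hγ hW hend
  haveI : Nonempty s := hne.to_subtype
  have hβ := minkowski_curve hγ
  have hu := strictMonoOn_u ha hs hγ
  have hr₁ : ∀ σ, r₁ < Kerr.radius a (γ σ) := fun σ => Kerr.lt_radius_of_mem_region (γ σ).2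
  have hcontF : Continuous fun p : E4 => p 0 - bentHeight M a (Kerr.radius a p) :=
    (PiLp.continuous_apply 2 _ 0).sub ((continuous_bentHeight ha).comp (Kerr.continuous_radius a))
  have hmem : ∀ q : E4, r₁ < Kerr.radius a q → q ∈ Kerr.region a r₁ := fun q hq => by
    rw [Kerr.mem_region, max_eq_left ((rMinus_nonneg ha).trans h₁.le)]; exact hq
  -- uniqueness by monotonicity of `u`; existence is what remains
  suffices hex : ∃ t ∈ s, (γ t : E4) 0 - bentHeight M a (Kerr.radius a (γ t)) = 0 by
    obtain ⟨t, ht, ht0⟩ := hex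
    refine ⟨t, ⟨ht, sub_eq_zero.1 ht0⟩, ?_⟩
    rintro t' ⟨ht', ht'0⟩
    refine hu.injOn ht' ht ?_
    rw [ht0, sub_eq_zero]
    exact ht'0
  by_contra hno
  push Not at hno
  obtain ⟨t₀, ht₀⟩ := hne
  have hcont : ContinuousOn (fun σ => (γ σ : E4) 0 - bentHeight M a (Kerr.radius a (γ σ))) s :=
    fun t ht => (hasDerivAt_u ha hγ ht).continuousAt.continuousWithinAt
  rcases lt_or_gt_of_ne (hno t₀ ht₀) with hneg | hpos
  · /- the curve lies below the leaf (`u < 0` on `s`, by the intermediate value theorem): futureward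
      escape.  `t*` is bounded above (`bddAbove_time_of_u_neg`), so the curve has a future endpoint `q`
      in `E4`; `w(q) ≥ w(t₀) > 0` and `u(q) ≤ 0` force `r(q) > r₁`, so `q ∈ W`: contradiction. -/
    have hall : ∀ t ∈ s, (γ t : E4) 0 - bentHeight M a (Kerr.radius a (γ t)) < 0 := by
      intro t ht
      by_contra hge
      push Not at hge
      obtain ⟨c, hc, hc0⟩ := hs.isPreconnected.intermediate_value ht₀ ht hcont ⟨hneg.le, hge⟩
      exact hno c hc hc0
    have hbdd := bddAbove_time_of_u_neg ha hs hγ hall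
    obtain ⟨q, hq⟩ : ∃ q : E4, HasFutureEndpoint (fun σ => (γ σ : E4)) s q := by
      by_contra hcon
      push Not at hcon
      exact Minkowski.not_bddAbove_time hs hβ ⟨⟨t₀, ht₀⟩, hcon⟩ hbdd
    have hqr : Tendsto (fun σ : s => Kerr.radius a (γ σ)) atTop (𝓝 (Kerr.radius a q)) :=
      ((Kerr.continuous_radius a).tendsto q).comp hq
    have hqu : Tendsto (fun σ : s => (γ σ : E4) 0 - bentHeight M a (Kerr.radius a (γ σ))) atTop
        (𝓝 (q 0 - bentHeight M a (Kerr.radius a q))) := (hcontF.tendsto q).comp hq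
    have hw := strictMonoOn_w ha h₁ hs hγ
    have hwq : (γ t₀ : E4) 0 - bentHeight M a (Kerr.radius a (γ t₀)) + (Kerr.radius a (γ t₀) - r₁) / 4 ≤
        q 0 - bentHeight M a (Kerr.radius a q) + (Kerr.radius a q - r₁) / 4 := by
      refine ge_of_tendsto (hqu.add ((hqr.sub_const r₁).div_const 4)) ?_
      filter_upwards [eventually_ge_atTop (⟨t₀, ht₀⟩ : s)] with σ hσ
      exact hw.monotoneOn ht₀ σ.2 hσ
    have huq : q 0 - bentHeight M a (Kerr.radius a q) ≤ 0 :=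
      le_of_tendsto' hqu fun σ => (hall σ σ.2).le
    have hW₀ := hW t₀ ht₀
    have hrq : r₁ < Kerr.radius a q := by
      by_contra hle
      push Not at hle
      linarith
    have hq' : HasFutureEndpoint γ s ⟨q, hmem q hrq⟩ :=
      (hasFutureEndpoint_subtypeVal_comp_iff (p := ⟨q, hmem q hrq⟩)).1 hq
    exact (hend ⟨q, hmem q hrq⟩
      (by change 0 < q 0 - bentHeight M a (Kerr.radius a q) + (Kerr.radius a q - r₁) / 4; linarith)).1 hq'
  · /- the curve lies above the leaf (`u > 0` on `s`): pastward escape.  `t* = u + T(r) > 0` is bounded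
      below, so the curve has a past endpoint `q` in `E4` with `u(q) ≥ 0`, `r(q) ≥ r₁`; if `r(q) > r₁`
      then `q ∈ W`, contradiction; if `r(q) = r₁ < r₊` the hole clock makes `r` increase pastward near
      the endpoint, contradiction. -/
    have hall : ∀ t ∈ s, 0 < (γ t : E4) 0 - bentHeight M a (Kerr.radius a (γ t)) := by
      intro t ht
      by_contra hle
      push Not at hle
      obtain ⟨c, hc, hc0⟩ := hs.isPreconnected.intermediate_value ht ht₀ hcont ⟨hle, hpos.le⟩
      exact hno c hc hc0
    have hbdd : BddBelow ((fun σ => (γ σ : E4) 0) '' s) := by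
      refine ⟨0, ?_⟩
      rintro _ ⟨σ, hσ, rfl⟩
      have hT := bentHeight_nonneg ha (Kerr.radius a (γ σ))
      have hu0 := hall σ hσ
      simp only
      linarith
    obtain ⟨q, hq⟩ : ∃ q : E4, HasPastEndpoint (fun σ => (γ σ : E4)) s q := by
      by_contra hcon
      push Not at hcon
      exact Minkowski.not_bddBelow_time hs hβ ⟨⟨t₀, ht₀⟩, hcon⟩ hbdd
    have hqr : Tendsto (fun σ : s => Kerr.radius a (γ σ)) atBot (𝓝 (Kerr.radius a q)) :=
      ((Kerr.continuous_radius a).tendsto q).comp hq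
    have hqu : Tendsto (fun σ : s => (γ σ : E4) 0 - bentHeight M a (Kerr.radius a (γ σ))) atBot
        (𝓝 (q 0 - bentHeight M a (Kerr.radius a q))) := (hcontF.tendsto q).comp hq
    have huq : 0 ≤ q 0 - bentHeight M a (Kerr.radius a q) :=
      ge_of_tendsto' hqu fun σ => (hall σ σ.2).le
    have hrq₁ : r₁ ≤ Kerr.radius a q := ge_of_tendsto' hqr fun σ => (hr₁ σ).le
    rcases hrq₁.lt_or_eq with hrq | hrq
    · have hq' : HasPastEndpoint γ s ⟨q, hmem q hrq⟩ :=
        (hasPastEndpoint_subtypeVal_comp_iff (p := ⟨q, hmem q hrq⟩)).1 hq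
      exact (hend ⟨q, hmem q hrq⟩
        (by change 0 < q 0 - bentHeight M a (Kerr.radius a q) + (Kerr.radius a q - r₁) / 4; linarith)).2 hq'
    · have hev : ∀ᶠ σ : s in atBot, Kerr.radius a (γ σ) < Kerr.rPlus M a :=
        hqr.eventually (Iio_mem_nhds (by rw [← hrq]; exact h₂))
      obtain ⟨σ₁, hσ₁⟩ := hev.exists_forall_of_atBot
      have hanti := strictAntiOn_radius ha h₁ (hs.inter ordConnected_Iic) inter_subset_left hγ
        (s' := s ∩ Iic (σ₁ : ℝ)) (fun σ hσ => hσ₁ ⟨σ, hσ.1⟩ hσ.2)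
      have hge : ∀ᶠ σ : s in atBot, Kerr.radius a (γ σ₁) ≤ Kerr.radius a (γ σ) := by
        filter_upwards [eventually_le_atBot σ₁] with σ hσ
        exact hanti.antitoneOn ⟨σ.2, hσ⟩ ⟨σ₁.2, self_mem_Iic⟩ hσ
      have hle := ge_of_tendsto hqr hge
      linarith [hr₁ σ₁]

end Summit.FinalStateConjecture.FinalStateConjecture.Theorems.SwallowTheDatum.KerrShieldedSettles

end
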